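import Mathlib.NumberTheory.Height.NumberField
import Mathlib.NumberTheory.Padics.PadicNumbers
import Mathlib.RingTheory.Algebraic.Integral
import HarnessLib

/-!
# Local-to-global height inequalities (tools for Liouville estimates)

Everything in this file is **proved**; there are no new definitions.  We work with M. Stoll's
heights `Height.mulHeight₁`, `Height.logHeight₁` (`Mathlib.NumberTheory.Height`) on a field `K`
with an admissible family of absolute values, and prove the elementary inequalities by which
transcendence proofs bound the height of a polynomial expression in algebraic numbers
(Waldschmidt, *Diophantine Approximation on Linear Algebraic Groups*, §3.2–3.5; Nesterenko–Philippon
LNM 1752, Ch. 2, Lemmas 2.8, 2.10):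

* `mulHeight₁_le_of_forall_absValue_le` — the **local-to-global principle**: if
  `v y ≤ C · ∏ᵢ max(v xᵢ, 1)^{eᵢ}` at every archimedean `v` and `v y ≤ ∏ᵢ max(v xᵢ, 1)^{eᵢ}` at
  every non-archimedean `v`, then `H(y) ≤ C^{[K:ℚ]} ∏ᵢ H(xᵢ)^{eᵢ}` (`[K:ℚ]` = `totalWeight K`).
* `absValue_sum_mul_pow_mul_pow_le`, `..._of_isNonarchimedean` — the local estimates for the value
  `Σ a_{ik} αⁱ βᵏ` of an integer polynomial, and the resulting
  `mulHeight₁_sum_mul_pow_mul_pow_le : H(P(α, β)) ≤ L(P)^{[K:ℚ]} H(α)^{D₁} H(β)^{D₂}`.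
* `absValue_le_max_one_sum_of_monic`, `absValue_le_max_one_sup_of_monic` — the local estimates
  for a root `y` of a monic relation `y^D + Σ_{k<D} b_k y^k = 0`:
  `v y ≤ max(1, Σ_k v b_k)`, resp. `v y ≤ max(1, B)` if all `v b_k ≤ B` and `v` is non-archimedean; and the
  consequence `absValue_le_one_of_isIntegral` (`v y ≤ 1` for `y` integral over `ℤ`, `v`
  non-archimedean).
* `mulHeight₁_natCast_le : H(n) ≤ n^{[K:ℚ]}` and, for number fields,
  `exists_logHeight₁_le_of_isAlgebraic` — **a fixed algebraic number has height `O([K:ℚ])`**: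
  for `z ∈ ℚ_p` algebraic over `ℚ` there is `c ≥ 0` with `logHeight₁ x ≤ c · [K:ℚ]` for every
  number field `K`, every embedding `σ : K →+* ℚ_p` and every `x ∈ K` with `σ x = z` (the relative
  height `logHeight₁ = [K:ℚ] · h` grows linearly in the degree, `h(z)` being absolute).

These are the inputs of the fourth step (Liouville estimate at `q^S`) of the `p`-adic proof of the
Mahler–Manin conjecture (Barré-Sirieix–Diaz–Gramain–Philibert 1996), see
`Literature.NumberTheory.Transcendental.MahlerManinPadic`.

## References

* M. Waldschmidt, *Diophantine Approximation on Linear Algebraic Groups*, Grundlehren 326,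
  Springer 2000, §3.2 (properties of the height), §3.5 (Liouville's inequality).
* [NesterenkoPhilippon2001] Yu. V. Nesterenko, P. Philippon (eds.), LNM 1752, Ch. 2 (G. Diaz),
  Lemma 2.8 (height of a root), Lemma 2.10 (Liouville inequality).
-/

noncomputable section

open Height Height.AdmissibleAbsValues Finset Function

namespace Literature.NumberTheory.Transcendental

/-! ### Local estimates for absolute values -/

section Local

variable {K : Type*} [Field K] (v : AbsoluteValue K ℝ)

/-- An absolute value of an integer is at most its usual absolute value: `v n ≤ |n|`. [folklore] -/
theorem absValue_intCast_le (n : ℤ) : v (n : K) ≤ |(n : ℝ)| := by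
  obtain ⟨m, rfl | rfl⟩ := Int.eq_nat_or_neg n
  · simpa using v.apply_nat_le_self m
  · simp only [Int.cast_neg, Int.cast_natCast, AbsoluteValue.map_neg, abs_neg, Nat.abs_cast]
    exact v.apply_nat_le_self m

/-- **Local estimate for an integer polynomial in two variables** (archimedean type): for any
absolute value `v`, `v(Σ_{(i,k) ∈ s} a_{ik} αⁱ βᵏ) ≤ (Σ |a_{ik}|) · max(v α, 1)^{D₁} · max(v β, 1)^{D₂}`
when `i ≤ D₁`, `k ≤ D₂` on `s`. [folklore] -/
theorem absValue_sum_mul_pow_mul_pow_le {s : Finset (ℕ × ℕ)} (a : ℕ × ℕ → ℤ) (α β : K)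
    {D₁ D₂ : ℕ} (hD : ∀ p ∈ s, p.1 ≤ D₁ ∧ p.2 ≤ D₂) :
    v (∑ p ∈ s, (a p : K) * α ^ p.1 * β ^ p.2) ≤
      (∑ p ∈ s, |(a p : ℝ)|) * max (v α) 1 ^ D₁ * max (v β) 1 ^ D₂ := by
  -- `v(x)^i ≤ max(v x, 1)^D` for `i ≤ D` (the tree's `abv_pow_le_max_pow`, inlined)
  have hpow : ∀ (x : K) {i D : ℕ}, i ≤ D → v x ^ i ≤ max (v x) 1 ^ D := fun x i D hi ↦
    (pow_le_pow_left₀ (v.nonneg x) (le_max_left _ _) i).trans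
      (pow_le_pow_right₀ (le_max_right _ _) hi)
  rw [sum_mul, sum_mul]
  refine (v.sum_le _ _).trans (sum_le_sum fun p hp ↦ ?_)
  rw [map_mul, map_mul, map_pow, map_pow]
  have h1 := absValue_intCast_le v (a p)
  have h2 := hpow α (hD p hp).1
  have h3 := hpow β (hD p hp).2
  have := v.nonneg (a p : K)
  have := pow_nonneg (v.nonneg α) p.1
  have := pow_nonneg (v.nonneg β) p.2
  gcongr

/-- **Local estimate for an integer polynomial in two variables** (non-archimedean type): for a
non-archimedean absolute value `v`, `v(Σ a_{ik} αⁱ βᵏ) ≤ max(v α, 1)^{D₁} · max(v β, 1)^{D₂}`.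
[folklore] -/
theorem absValue_sum_mul_pow_mul_pow_le_of_isNonarchimedean {v : AbsoluteValue K ℝ}
    (hv : IsNonarchimedean v) {s : Finset (ℕ × ℕ)} (a : ℕ × ℕ → ℤ) (α β : K) {D₁ D₂ : ℕ}
    (hD : ∀ p ∈ s, p.1 ≤ D₁ ∧ p.2 ≤ D₂) :
    v (∑ p ∈ s, (a p : K) * α ^ p.1 * β ^ p.2) ≤ max (v α) 1 ^ D₁ * max (v β) 1 ^ D₂ := by
  rcases s.eq_empty_or_nonempty with rfl | hs
  · simp only [sum_empty, map_zero]
    positivity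
  have hpow : ∀ (x : K) {i D : ℕ}, i ≤ D → v x ^ i ≤ max (v x) 1 ^ D := fun x i D hi ↦
    (pow_le_pow_left₀ (v.nonneg x) (le_max_left _ _) i).trans
      (pow_le_pow_right₀ (le_max_right _ _) hi)
  refine (hv.apply_sum_le_sup hs).trans (sup'_le hs _ fun p hp ↦ ?_)
  rw [map_mul, map_mul, map_pow, map_pow]
  have h1 : v (a p : K) ≤ 1 := hv.apply_intCast_le_one
  have h2 := hpow α (hD p hp).1
  have h3 := hpow β (hD p hp).2
  have := v.nonneg (a p : K)
  have := pow_nonneg (v.nonneg α) p.1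
  have := pow_nonneg (v.nonneg β) p.2
  calc v (a p : K) * v α ^ p.1 * v β ^ p.2 ≤ 1 * max (v α) 1 ^ D₁ * max (v β) 1 ^ D₂ := by gcongr
    _ = _ := by rw [one_mul]

/-- **Local estimate for a root of a monic relation** (archimedean type): if
`y^D + Σ_{k<D} b_k y^k = 0` then `v y ≤ max(1, Σ_{k<D} v b_k)`. [folklore] -/
theorem absValue_le_max_one_sum_of_monic {D : ℕ} (b : ℕ → K) {y : K}
    (hrel : y ^ D + ∑ k ∈ range D, b k * y ^ k = 0) :
    v y ≤ max 1 (∑ k ∈ range D, v (b k)) := by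
  rcases le_or_gt (v y) 1 with hy | hy
  · exact hy.trans (le_max_left _ _)
  refine le_max_of_le_right ?_
  -- `D ≥ 1`, and `v(y)^D ≤ (Σ v b_k) v(y)^{D-1}`
  rcases Nat.eq_zero_or_pos D with rfl | hD
  · simp only [pow_zero, range_zero, sum_empty, add_zero, one_ne_zero] at hrel
  obtain ⟨E, rfl⟩ : ∃ E, D = E + 1 := ⟨D - 1, (Nat.sub_add_cancel hD).symm⟩
  have hy0 : 0 < v y := one_pos.trans hy
  have hyE : 0 < v y ^ E := pow_pos hy0 E
  have key : v y ^ (E + 1) ≤ (∑ k ∈ range (E + 1), v (b k)) * v y ^ E := by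
    have h1 : y ^ (E + 1) = -∑ k ∈ range (E + 1), b k * y ^ k := eq_neg_of_add_eq_zero_left hrel
    calc v y ^ (E + 1) = v (∑ k ∈ range (E + 1), b k * y ^ k) := by
          rw [← AbsoluteValue.map_pow, h1, AbsoluteValue.map_neg]
      _ ≤ ∑ k ∈ range (E + 1), v (b k * y ^ k) := v.sum_le _ _
      _ ≤ ∑ k ∈ range (E + 1), v (b k) * v y ^ E := sum_le_sum fun k hk ↦ by
          rw [map_mul, map_pow]
          exact mul_le_mul_of_nonneg_left
            (pow_le_pow_right₀ hy.le (Nat.lt_succ_iff.mp (mem_range.mp hk))) (v.nonneg _)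
      _ = (∑ k ∈ range (E + 1), v (b k)) * v y ^ E := by rw [sum_mul]
  rw [pow_succ, mul_comm] at key
  exact le_of_mul_le_mul_right key hyE

/-- **Local estimate for a root of a monic relation** (non-archimedean type): if
`y^D + Σ_{k<D} b_k y^k = 0` and `v` is non-archimedean then `v y ≤ max(1, max_{k<D} v b_k)`.
[folklore] -/
theorem absValue_le_max_one_sup_of_monic {v : AbsoluteValue K ℝ} (hv : IsNonarchimedean v)
    {D : ℕ} (b : ℕ → K) {y : K} (hrel : y ^ D + ∑ k ∈ range D, b k * y ^ k = 0) {B : ℝ}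
    (hB : ∀ k < D, v (b k) ≤ B) : v y ≤ max 1 B := by
  rcases le_or_gt (v y) 1 with hy | hy
  · exact hy.trans (le_max_left _ _)
  refine le_max_of_le_right ?_
  rcases Nat.eq_zero_or_pos D with rfl | hD
  · simp only [pow_zero, range_zero, sum_empty, add_zero, one_ne_zero] at hrel
  obtain ⟨E, rfl⟩ : ∃ E, D = E + 1 := ⟨D - 1, (Nat.sub_add_cancel hD).symm⟩
  have hy0 : 0 < v y := one_pos.trans hy
  have hyE : 0 < v y ^ E := pow_pos hy0 E
  have hne : (range (E + 1)).Nonempty := nonempty_range_add_one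
  have key : v y ^ (E + 1) ≤ B * v y ^ E := by
    have h1 : y ^ (E + 1) = -∑ k ∈ range (E + 1), b k * y ^ k := eq_neg_of_add_eq_zero_left hrel
    calc v y ^ (E + 1) = v (∑ k ∈ range (E + 1), b k * y ^ k) := by
          rw [← AbsoluteValue.map_pow, h1, AbsoluteValue.map_neg]
      _ ≤ (range (E + 1)).sup' hne fun k ↦ v (b k * y ^ k) := hv.apply_sum_le_sup hne
      _ ≤ B * v y ^ E := sup'_le hne _ fun k hk ↦ by
          rw [map_mul, map_pow]
          have hk' := mem_range.mp hk
          exact mul_le_mul (hB k hk') (pow_le_pow_right₀ hy.le (Nat.lt_succ_iff.mp hk'))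
            (pow_nonneg (v.nonneg y) k) ((v.nonneg _).trans (hB k hk'))
  rw [pow_succ, mul_comm] at key
  exact le_of_mul_le_mul_right key hyE

/-- **Algebraic integers are `v`-integral for non-archimedean `v`**: `v y ≤ 1` for `y` integral
over `ℤ` and `v` a non-archimedean absolute value. [folklore] -/
theorem absValue_le_one_of_isIntegral {v : AbsoluteValue K ℝ} (hv : IsNonarchimedean v) {y : K}
    (hy : IsIntegral ℤ y) : v y ≤ 1 := by
  obtain ⟨P, hmonic, hP⟩ := hy
  have hrel : y ^ P.natDegree + ∑ k ∈ range P.natDegree, (P.coeff k : K) * y ^ k = 0 := by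
    rw [Polynomial.eval₂_eq_sum_range, sum_range_succ, hmonic.coeff_natDegree] at hP
    simp only [eq_intCast, Int.cast_one, one_mul] at hP
    rw [add_comm]
    exact hP
  have h := absValue_le_max_one_sup_of_monic hv (fun k ↦ (P.coeff k : K)) hrel (B := 1)
    fun k _ ↦ hv.apply_intCast_le_one
  rwa [max_self] at h

end Local

/-! ### The local-to-global principle -/

section Global

variable {K : Type*} [Field K] [AdmissibleAbsValues K]

/-- `v ↦ max (v x) 1` has finite multiplicative support on the non-archimedean absolute values.
[folklore] -/
theorem hasFiniteMulSupport_max_one (x : K) :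
    (fun v : nonarchAbsVal ↦ max (v.val x) 1).HasFiniteMulSupport := by
  rcases eq_or_ne x 0 with rfl | hx
  · simp only [map_zero, zero_le_one, max_eq_right]
    exact hasFiniteMulSupport_one
  · exact (hasFiniteMulSupport hx).max hasFiniteMulSupport_one

/-- `v ↦ ∏ᵢ max (v xᵢ) 1 ^ eᵢ` has finite multiplicative support on the non-archimedean absolute
values. [folklore] -/
theorem hasFiniteMulSupport_prod_max_one_pow {ι : Type*} (s : Finset ι) (x : ι → K) (e : ι → ℕ) :
    (fun v : nonarchAbsVal ↦ ∏ i ∈ s, max (v.val (x i)) 1 ^ e i).HasFiniteMulSupport := by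
  refine HasFiniteMulSupport.prod (fun i ↦ ?_) s
  exact (hasFiniteMulSupport_max_one (x i)).pow (e i)

/-- **Local-to-global principle for heights.**  Let `C ≥ 1`.  If `v y ≤ C ∏ᵢ max(v xᵢ, 1)^{eᵢ}` for
every archimedean absolute value `v` of the admissible family and `v y ≤ ∏ᵢ max(v xᵢ, 1)^{eᵢ}` for
every non-archimedean one, then `H(y) ≤ C^{totalWeight K} ∏ᵢ H(xᵢ)^{eᵢ}` (Waldschmidt, GL326,
§3.2). [folklore] -/
theorem mulHeight₁_le_of_forall_absValue_le {ι : Type*} (s : Finset ι) {y : K} {x : ι → K}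
    {e : ι → ℕ} {C : ℝ} (hC : 1 ≤ C)
    (harch : ∀ v ∈ archAbsVal, v y ≤ C * ∏ i ∈ s, max (v (x i)) 1 ^ e i)
    (hna : ∀ v ∈ nonarchAbsVal, v y ≤ ∏ i ∈ s, max (v (x i)) 1 ^ e i) :
    mulHeight₁ y ≤ C ^ totalWeight K * ∏ i ∈ s, mulHeight₁ (x i) ^ e i := by
  have hone : ∀ v : AbsoluteValue K ℝ, 1 ≤ ∏ i ∈ s, max (v (x i)) 1 ^ e i := fun v ↦
    one_le_prod fun i _ ↦ one_le_pow₀ (le_max_right _ _)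
  -- archimedean part
  have hA : (archAbsVal.map fun v ↦ max (v y) 1).prod ≤
      (archAbsVal.map fun v ↦ C * ∏ i ∈ s, max (v (x i)) 1 ^ e i).prod := by
    refine Multiset.prod_map_le_prod_map₀ _ _ (fun v _ ↦ by positivity) fun v hv ↦ max_le (harch v hv) ?_
    calc (1 : ℝ) = 1 * 1 := (mul_one 1).symm
      _ ≤ C * ∏ i ∈ s, max (v (x i)) 1 ^ e i := mul_le_mul hC (hone v) zero_le_one (by linarith)
  have hA' : (archAbsVal.map fun v ↦ C * ∏ i ∈ s, max (v (x i)) 1 ^ e i).prod =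
      C ^ totalWeight K * ∏ i ∈ s, (archAbsVal.map fun v ↦ max (v (x i)) 1).prod ^ e i := by
    rw [Multiset.prod_map_mul, Multiset.map_const', Multiset.prod_replicate, Multiset.prod_map_prod,
      totalWeight]
    congr 1
    exact prod_congr rfl fun i _ ↦ Multiset.prod_map_pow
  -- non-archimedean part
  have hN : ∏ᶠ v : nonarchAbsVal, max (v.val y) 1 ≤
      ∏ᶠ v : nonarchAbsVal, ∏ i ∈ s, max (v.val (x i)) 1 ^ e i :=
    finprod_le_finprod (hasFiniteMulSupport_max_one y) (fun v ↦ by positivity)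
      (hasFiniteMulSupport_prod_max_one_pow s x e) fun v ↦ max_le (hna v.val v.prop) (hone v.val)
  have hN' : ∏ᶠ v : nonarchAbsVal, ∏ i ∈ s, max (v.val (x i)) 1 ^ e i =
      ∏ i ∈ s, (∏ᶠ v : nonarchAbsVal, max (v.val (x i)) 1) ^ e i := by
    rw [finprod_prod_comm s (fun (v : nonarchAbsVal) i ↦ max (v.val (x i)) 1 ^ e i)
      fun i _ ↦ (hasFiniteMulSupport_max_one (x i)).pow (e i)]
    exact prod_congr rfl fun i _ ↦ (finprod_pow (hasFiniteMulSupport_max_one (x i)) (e i)).symm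
  -- combine
  have hApos : 0 ≤ (archAbsVal.map fun v ↦ max (v y) 1).prod :=
    Multiset.prod_nonneg fun a ha ↦ by
      obtain ⟨v, _, rfl⟩ := Multiset.mem_map.mp ha
      positivity
  have hNpos : 0 ≤ ∏ᶠ v : nonarchAbsVal, ∏ i ∈ s, max (v.val (x i)) 1 ^ e i :=
    finprod_nonneg fun v ↦ by positivity
  calc mulHeight₁ y
      = (archAbsVal.map fun v ↦ max (v y) 1).prod * ∏ᶠ v : nonarchAbsVal, max (v.val y) 1 :=
        mulHeight₁_eq y
    _ ≤ (C ^ totalWeight K * ∏ i ∈ s, (archAbsVal.map fun v ↦ max (v (x i)) 1).prod ^ e i) *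
          ∏ i ∈ s, (∏ᶠ v : nonarchAbsVal, max (v.val (x i)) 1) ^ e i := by
        rw [← hA', ← hN']
        exact mul_le_mul hA hN (finprod_nonneg fun v ↦ by positivity) (hApos.trans hA)
    _ = C ^ totalWeight K * ∏ i ∈ s, mulHeight₁ (x i) ^ e i := by
        rw [mul_assoc, ← prod_mul_distrib]
        congr 1
        exact prod_congr rfl fun i _ ↦ by rw [← mul_pow, mulHeight₁_eq]

/-- **Height of the value of an integer polynomial**: for `P = Σ_{(i,k) ∈ s} a_{ik} Xⁱ Yᵏ ∈ ℤ[X, Y]`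
with `deg_X P ≤ D₁`, `deg_Y P ≤ D₂` and `L(P) = Σ |a_{ik}|`,
`H(P(α, β)) ≤ max(1, L(P))^{totalWeight K} · H(α)^{D₁} · H(β)^{D₂}` (Waldschmidt GL326 §3.2;
the logarithmic form is the bound `h(P(α)) ≤ log L(P) + Σ deg_j P · h(α_j)` behind Lemma 2.10 of
Nesterenko–Philippon Ch. 2). [cite: NesterenkoPhilippon2001, Ch. 2, Lemma 2.10] -/
theorem mulHeight₁_sum_mul_pow_mul_pow_le {s : Finset (ℕ × ℕ)} (a : ℕ × ℕ → ℤ) (α β : K)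
    {D₁ D₂ : ℕ} (hD : ∀ p ∈ s, p.1 ≤ D₁ ∧ p.2 ≤ D₂) :
    mulHeight₁ (∑ p ∈ s, (a p : K) * α ^ p.1 * β ^ p.2) ≤
      (max 1 (∑ p ∈ s, |(a p : ℝ)|)) ^ totalWeight K * mulHeight₁ α ^ D₁ * mulHeight₁ β ^ D₂ := by
  have hloc : ∀ v : AbsoluteValue K ℝ,
      ∏ i : Fin 2, max (v (![α, β] i)) 1 ^ ![D₁, D₂] i = max (v α) 1 ^ D₁ * max (v β) 1 ^ D₂ :=
    fun v ↦ by rw [Fin.prod_univ_two]; rfl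
  have hglob : ∏ i : Fin 2, mulHeight₁ (![α, β] i) ^ ![D₁, D₂] i = mulHeight₁ α ^ D₁ * mulHeight₁ β ^ D₂ := by
    rw [Fin.prod_univ_two]; rfl
  have h := mulHeight₁_le_of_forall_absValue_le (K := K) (univ : Finset (Fin 2))
    (y := ∑ p ∈ s, (a p : K) * α ^ p.1 * β ^ p.2) (x := ![α, β]) (e := ![D₁, D₂])
    (C := max 1 (∑ p ∈ s, |(a p : ℝ)|)) (le_max_left _ _) (fun v _ ↦ ?_) (fun v hv ↦ ?_)
  · rw [hglob, ← mul_assoc] at h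
    exact h
  · rw [hloc, ← mul_assoc]
    refine (absValue_sum_mul_pow_mul_pow_le v a α β hD).trans ?_
    gcongr
    exact le_max_right _ _
  · rw [hloc]
    exact absValue_sum_mul_pow_mul_pow_le_of_isNonarchimedean (isNonarchimedean v hv) a α β hD

/-- **Height of a positive integer**: `H(n) ≤ n^{totalWeight K}`. [folklore] -/
theorem mulHeight₁_natCast_le (n : ℕ) (hn : n ≠ 0) : mulHeight₁ (n : K) ≤ (n : ℝ) ^ totalWeight K := by
  have h := mulHeight₁_le_of_forall_absValue_le (K := K) (∅ : Finset ℕ) (y := (n : K))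
    (x := fun _ ↦ 0) (e := fun _ ↦ 0) (C := n) (by exact_mod_cast Nat.one_le_iff_ne_zero.mpr hn)
    (fun v _ ↦ by simpa using v.apply_nat_le_self n)
    (fun v hv ↦ by simpa using (isNonarchimedean v hv).apply_natCast_le_one)
  simpa using h

end Global

/-! ### Number fields: a fixed algebraic number has height `O([K:ℚ])` -/

section NumberField

open NumberField

/-- **The height of a fixed algebraic number grows linearly in the degree.**  Let `z ∈ ℚ_p` be
algebraic over `ℚ`.  There is a constant `c ≥ 0` such that for every number field `K`, every
ring homomorphism `σ : K →+* ℚ_p` and every `x ∈ K` with `σ x = z`: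
`logHeight₁ x ≤ c · [K : ℚ]`.  (Mathlib's `logHeight₁` on a number field is the relative height
`[K:ℚ] · h`, `h` the absolute logarithmic Weil height; `c` is any bound for
`log (d · max(1, house(z))) + log d` with `d z` an algebraic integer.) [folklore] -/
theorem exists_logHeight₁_le_of_isAlgebraic {p : ℕ} [Fact p.Prime] {z : ℚ_[p]}
    (hz : IsAlgebraic ℚ z) :
    ∃ c : ℝ, 0 ≤ c ∧ ∀ (K : Type) [Field K] [NumberField K] (σ : K →+* ℚ_[p]) (x : K),
      σ x = z → logHeight₁ x ≤ c * Module.finrank ℚ K := by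
  -- an integer multiple `d z` which is an algebraic integer
  haveI : Algebra.IsAlgebraic ℤ ℚ := IsLocalization.isAlgebraic ℚ (nonZeroDivisors ℤ)
  obtain ⟨d, hd0, hint⟩ := (hz.restrictScalars ℤ).exists_integral_multiple
  -- a bound `R` for the complex roots of the minimal polynomial of `z`
  set m : Polynomial ℚ := minpoly ℚ z with hm
  have hm0 : m ≠ 0 := minpoly.ne_zero hz.isIntegral
  set rts : Multiset ℂ := (m.map (algebraMap ℚ ℂ)).roots with hrts
  set R : ℝ := (rts.map fun w ↦ ‖w‖).sum with hR
  have hR0 : 0 ≤ R := Multiset.sum_nonneg fun r hr ↦ by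
    obtain ⟨w, _, rfl⟩ := Multiset.mem_map.mp hr
    exact norm_nonneg w
  have hRroot : ∀ w ∈ rts, ‖w‖ ≤ R := fun w hw ↦
    Multiset.single_le_sum (fun r hr ↦ by
      obtain ⟨w', _, rfl⟩ := Multiset.mem_map.mp hr
      exact norm_nonneg w') _ (Multiset.mem_map_of_mem _ hw)
  -- the constant
  set dR : ℝ := |(d : ℝ)| with hdR
  have hd1 : 1 ≤ dR := by
    rw [hdR, ← Int.cast_abs]
    exact_mod_cast Int.one_le_abs hd0
  refine ⟨Real.log (max 1 (dR * R)) + Real.log dR,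
    add_nonneg (Real.log_nonneg (le_max_left _ _)) (Real.log_nonneg hd1), ?_⟩
  intro K _ _ σ x hx
  -- (1) `m(x) = 0` in `K`
  have hmx : Polynomial.aeval x m = 0 := by
    apply σ.injective
    rw [map_zero, ← RingHom.toRatAlgHom_apply σ (Polynomial.aeval x m),
      ← Polynomial.aeval_algHom_apply, RingHom.toRatAlgHom_apply, hx, hm, minpoly.aeval]
  -- (2) `d x` is integral over `ℤ`
  have hdx : IsIntegral ℤ ((d : K) * x) := by
    refine (isIntegral_algHom_iff σ.toIntAlgHom σ.injective).mp ?_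
    rw [RingHom.toIntAlgHom_apply, map_mul, map_intCast, hx, ← zsmul_eq_mul]
    exact hint
  -- (3) archimedean local bound for `d x`: `v (d x) ≤ dR * R`
  have harch : ∀ v ∈ (archAbsVal : Multiset (AbsoluteValue K ℝ)), v ((d : K) * x) ≤ dR * R := by
    intro v hv
    change v ∈ multisetInfinitePlace K at hv
    rw [mem_multisetInfinitePlace] at hv
    obtain ⟨φ, rfl⟩ := hv
    rw [NumberField.place_apply, map_mul, norm_mul, map_intCast, Complex.norm_intCast]
    refine mul_le_mul_of_nonneg_left (hRroot _ ?_) (abs_nonneg _)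
    rw [hrts, Polynomial.mem_roots (Polynomial.map_ne_zero hm0), Polynomial.IsRoot,
      Polynomial.eval_map, ← Polynomial.aeval_def, ← RingHom.toRatAlgHom_apply φ x,
      Polynomial.aeval_algHom_apply, hmx, map_zero]
  -- (4) heights
  have hH1 : mulHeight₁ ((d : K) * x) ≤ (max 1 (dR * R)) ^ totalWeight K := by
    have h := mulHeight₁_le_of_forall_absValue_le (K := K) (∅ : Finset ℕ) (y := (d : K) * x)
      (x := fun _ ↦ 0) (e := fun _ ↦ 0) (C := max 1 (dR * R)) (le_max_left _ _)
      (fun v hv ↦ by simpa using (harch v hv).trans (le_max_right 1 _))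
      (fun v hv ↦ by simpa using absValue_le_one_of_isIntegral (isNonarchimedean v hv) hdx)
    simpa using h
  have hH2 : mulHeight₁ ((d : K)⁻¹) ≤ dR ^ totalWeight K := by
    rw [mulHeight₁_inv]
    have h := mulHeight₁_le_of_forall_absValue_le (K := K) (∅ : Finset ℕ) (y := (d : K))
      (x := fun _ ↦ 0) (e := fun _ ↦ 0) (C := dR) hd1
      (fun v _ ↦ by simpa [hdR] using absValue_intCast_le v d)
      (fun v hv ↦ by simpa using (isNonarchimedean v hv).apply_intCast_le_one (n := d))
    simpa using h
  have hd0' : (d : K) ≠ 0 := Int.cast_ne_zero.mpr hd0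
  have hxeq : x = (d : K) * x * (d : K)⁻¹ := by field_simp
  have hH : mulHeight₁ x ≤ (max 1 (dR * R)) ^ totalWeight K * dR ^ totalWeight K := by
    rw [hxeq]
    refine (mulHeight₁_mul_le _ _).trans ?_
    exact mul_le_mul hH1 hH2 (mulHeight₁_pos _).le (by positivity)
  -- logarithms
  rw [logHeight₁_eq_log_mulHeight₁, ← totalWeight_eq_finrank]
  have hpos : 0 < (max 1 (dR * R)) ^ totalWeight K * dR ^ totalWeight K := by positivity
  calc Real.log (mulHeight₁ x) ≤ Real.log ((max 1 (dR * R)) ^ totalWeight K * dR ^ totalWeight K) :=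
        Real.log_le_log (mulHeight₁_pos x) hH
    _ = (Real.log (max 1 (dR * R)) + Real.log dR) * totalWeight K := by
        rw [Real.log_mul (by positivity) (by positivity), Real.log_pow, Real.log_pow]
        ring

end NumberField

end Literature.NumberTheory.Transcendental

end
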